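import Summits.NavierStokesRegularity.FunctionalMining.NoGo.TopEigHeatMomentTransport
import HarnessLib

/-!
# FunctionalMining / NoGo — K68: the TWO-CHANNEL RULE AT LEVEL `q` on everywhere-simple fields of `T³`
# `Φ_q(v)² ≤ [((q−1)/q) ∫‖v‖²λ₁^{q−2} + (3/q) ∫‖v‖²λ₁^{q−1}/(λ₁ − λ₂)] · heatDissipation Φ_q v`, `q ≥ 1`

HONEST FRAMING. Search for candidate a priori estimates; no regularity claim. Nothing about
Navier–Stokes is proved or asserted in this file. Cell `pub-nsfunc`, no-go seat (gen 54). Door (e) box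
of `NOGO.md` (STRUCTURE ONLY): a constraint on the SHAPE of a killing family for the open node
Lemma L-λ(q) = `TopEigHeatCoercivePos q` (door (b)/(F2) wants `¬ TopEigHeatCoercivePos q`: smooth
divergence-free `v_n` on `T³` with `heatDissipation Φ_q v_n ≤ c_n Φ_q(v_n)`, `c_n → 0`;
`Φ_q = torusTopEigMoment q = ∫ (λ₁⁺)^q`, `λ₁ ≥ λ₂ ≥ λ₃` the strain eigenvalues).
SETTING (as in K67 `NoGo.TopEigHeatMomentTransport`). `v` smooth, divergence free on `T³`, top strain
eigenvalue SIMPLE AT EVERY POINT; `P₁ = topProj v`; `|∇P₁|² = Σₖᵢⱼ (∂ₖ(P₁)ᵢⱼ)²`, `|∇λ₁|² = Σₖ (∂ₖλ₁)²`;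
`w_q = qλ₁^{q−1}(λ₁ − λ₂)`; `E(v) = ∫ ‖v‖²`.
CONTENT. Cauchy–Schwarz ACROSS the two channels of K67: with the heat integrand
`X = q(q−1)λ₁^{q−2}|∇λ₁|² + w_q|∇P₁|²` (K67 § 3: `∫ X ≤ heat`) and the field-side weight
`Y = ((q−1)/q)‖v‖²λ₁^{q−2} + (3/q)‖v‖²λ₁^{q−1}/(λ₁ − λ₂)`,
§ 1 **`abs_transport_rpow_topProj_le_sqrt_mul_sqrt`** (pointwise, `q ≥ 1`): `|Σⱼ vⱼ Σᵢ ∂ᵢ(λ₁^{q−1}(P₁)ᵢⱼ)|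
≤ √X √Y` (K67 § 2 and `√(X₁Y₁) + √(X₂Y₂) ≤ √(X₁+X₂)√(Y₁+Y₂)`).
§ 2 MASTER RULE AT LEVEL `q` (R15) **`topEigMoment_sq_le_channels_mul_heatDissipation`** (`q ≥ 1`):
`Φ_q(v)² ≤ [((q−1)/q) ∫‖v‖²λ₁^{q−2} + (3/q) ∫‖v‖²λ₁^{q−1}/(λ₁ − λ₂)] · heatDissipation Φ_q v`
(K67 § 1 transport identity, § 1, Hölder, K67 § 3).
§ 3 KILL RULE (R15′) **`topEigMoment_le_channels_of_heat_le`**: `heat ≤ c Φ_q(v)`, `Φ_q(v) > 0` ⇒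
`Φ_q(v) ≤ c [((q−1)/q) ∫‖v‖²λ₁^{q−2} + (3/q) ∫‖v‖²λ₁^{q−1}/(λ₁ − λ₂)]`; at `q = 2`
**`topEigMoment_two_le_of_heat_le`**: `Φ₂(v) ≤ c [E(v)/2 + (3/2) ∫‖v‖²λ₁/(λ₁ − λ₂)]`.
MEANING. Along an everywhere-simple killing family for L-λ(q) (`c_n → 0`) ONE of two weighted quantities
must blow up relative to `Φ_q`: the AMPLITUDE CHANNEL `∫‖v‖²λ₁^{q−2}` or the GAP CHANNEL
`∫‖v‖²λ₁^{q−1}/(λ₁ − λ₂)`. At `q = 2` the amplitude channel is the bare energy, so at bounded `E/Φ₂` the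
kill must come from the `λ₁‖v‖²`-weighted inverse gap: the gap closes where the field AND `λ₁` are large.
Unlike K66's (R14″) `Φ₁² ≤ 3(∫‖v‖²/w_q)·heat`, (R15) carries the natural weight `λ₁^{q−1}` of `Φ_q` and
never passes through `Φ₁`.
NOT CLAIMED: fields with eigenvalue crossings; any energy–`Φ₂` comparison (pen remark only); any sign
of `heatDissipation` beyond the tree's; any verdict on L-λ(q): OPEN in the kernel for every real `q > 1`;
(F2) WANTED/OPEN; no node decided. [ours = §§ 1–3 as stated; folklore = Cauchy–Schwarz, Hölder — via
the tree and Mathlib]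
FILING (prove seat g31, REQUEST #97): declarations byte-identical to the no-go seat's staged `TopEigHeatChannelRule.STAGING.lean` 1e7b74f755b7a2cd; this line is the only addition.
-/

noncomputable section

open Filter Topology Matrix Finset MeasureTheory
open scoped ContDiff

namespace Summit.NavierStokesRegularity.FunctionalMining

open Literature.Analysis Literature.Analysis.FunctionSpaces Literature.Analysis.FunctionSpaces.Torus
  SharpClass.DirectorForm Literature.Analysis.Matrix

namespace TopEig.InverseGap

variable {v : UnitAddTorus (Fin 3) → EuclideanSpace ℝ (Fin 3)} {q : ℝ}

/-- Gap form at every point, in the `∃`-shape the tree's simple-case theorems take. [tree, bookkeeping] -/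
private theorem gapForm_of_simple''
    (hsimple : ∀ x : UnitAddTorus (Fin 3), torusStrainMidEig v x < torusStrainTopEig v x)
    (x : UnitAddTorus (Fin 3)) :
    ∃ (e : Fin 3 → ℝ) (lam g : ℝ), e ⬝ᵥ e = 1 ∧ torusStrainMatrix v x *ᵥ e = lam • e ∧ 0 < g ∧
      ∀ w, w ⬝ᵥ e = 0 → w ⬝ᵥ torusStrainMatrix v x *ᵥ w ≤ (lam - g) * (w ⬝ᵥ w) :=
  let ⟨e, he1, hSe, hg, hgap⟩ := exists_gapForm_of_midEig_lt_topEig (hsimple x)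
  ⟨e, _, _, he1, hSe, hg, hgap⟩

/-- `λ₁ > 0` everywhere on an everywhere-simple divergence-free field. [tree] -/
private theorem topEig_pos'' (hv : Torus.IsSmooth v) (hdiv : Torus.IsDivFree v)
    (hsimple : ∀ x : UnitAddTorus (Fin 3), torusStrainMidEig v x < torusStrainTopEig v x)
    (x : UnitAddTorus (Fin 3)) : 0 < torusStrainTopEig v x := by
  obtain ⟨e, he1, hSe, hg, hgap⟩ := exists_gapForm_of_midEig_lt_topEig (hsimple x)
  exact (lam_pos_of_gapForm_of_isDivFree hv hdiv he1 hSe hg hgap).2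

/-- Cauchy–Schwarz in `ℝ²` for square roots: `√X₁√Y₁ + √X₂√Y₂ ≤ √(X₁+X₂) √(Y₁+Y₂)`. [folklore] -/
private theorem sqrt_mul_sqrt_add_le {X₁ X₂ Y₁ Y₂ : ℝ} (hX₁ : 0 ≤ X₁) (hX₂ : 0 ≤ X₂) (hY₁ : 0 ≤ Y₁)
    (hY₂ : 0 ≤ Y₂) :
    Real.sqrt X₁ * Real.sqrt Y₁ + Real.sqrt X₂ * Real.sqrt Y₂ ≤
      Real.sqrt (X₁ + X₂) * Real.sqrt (Y₁ + Y₂) := by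
  rw [← Real.sqrt_mul (add_nonneg hX₁ hX₂)]
  refine (le_abs_self _).trans (Real.abs_le_sqrt ?_)
  rw [show (X₁ + X₂) * (Y₁ + Y₂) = (Real.sqrt X₁ ^ 2 + Real.sqrt X₂ ^ 2) *
    (Real.sqrt Y₁ ^ 2 + Real.sqrt Y₂ ^ 2) by
    rw [Real.sq_sqrt hX₁, Real.sq_sqrt hX₂, Real.sq_sqrt hY₁, Real.sq_sqrt hY₂]]
  nlinarith [sq_nonneg (Real.sqrt X₁ * Real.sqrt Y₂ - Real.sqrt X₂ * Real.sqrt Y₁)]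

/-- **§ 1 pointwise two-channel Cauchy–Schwarz**: with `X = q(q−1)λ₁^{q−2}|∇λ₁|² + w_q|∇P₁|²` (the heat
integrand of K67 § 3) and `Y = ((q−1)/q)‖v‖²λ₁^{q−2} + (3/q)‖v‖²λ₁^{q−1}/(λ₁ − λ₂)`,
`|Σⱼ vⱼ Σᵢ ∂ᵢ(λ₁^{q−1}(P₁)ᵢⱼ)| ≤ √X √Y` (`q ≥ 1`, everywhere simple). [ours] -/
theorem abs_transport_rpow_topProj_le_sqrt_mul_sqrt (hq : 1 ≤ q) (hv : Torus.IsSmooth v)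
    (hdiv : Torus.IsDivFree v)
    (hsimple : ∀ x : UnitAddTorus (Fin 3), torusStrainMidEig v x < torusStrainTopEig v x)
    (x : UnitAddTorus (Fin 3)) :
    |∑ j, v x j * ∑ i, Torus.partialDeriv i
        (fun y => torusStrainTopEig v y ^ (q - 1) * topProj v y i j) x| ≤
      Real.sqrt (q * (q - 1) * torusStrainTopEig v x ^ (q - 2) *
            ∑ k, Torus.partialDeriv k (torusStrainTopEig v) x ^ 2 +
          q * torusStrainTopEig v x ^ (q - 1) * (torusStrainTopEig v x - torusStrainMidEig v x) *
            ∑ k, ∑ i, ∑ j, Torus.partialDeriv k (fun y => topProj v y i j) x ^ 2) *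
        Real.sqrt ((q - 1) / q * (‖v x‖ ^ 2 * torusStrainTopEig v x ^ (q - 2)) +
          3 / q * (‖v x‖ ^ 2 * torusStrainTopEig v x ^ (q - 1) /
            (torusStrainTopEig v x - torusStrainMidEig v x))) := by
  have hpos := topEig_pos'' hv hdiv hsimple x
  have hgap : 0 < torusStrainTopEig v x - torusStrainMidEig v x := sub_pos.2 (hsimple x)
  have hq0 : 0 < q := by linarith
  have hq1 : 0 ≤ q - 1 := by linarith
  set L := torusStrainTopEig v x with hL
  set S := ∑ k, Torus.partialDeriv k (torusStrainTopEig v) x ^ 2 with hS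
  set G := ∑ k, ∑ i, ∑ j, Torus.partialDeriv k (fun y => topProj v y i j) x ^ 2 with hG
  set N := ‖v x‖ with hN
  have hS0 : 0 ≤ S := Finset.sum_nonneg fun k _ => sq_nonneg _
  have hG0 : 0 ≤ G := Finset.sum_nonneg fun k _ => Finset.sum_nonneg fun i _ =>
    Finset.sum_nonneg fun j _ => sq_nonneg _
  have hN0 : 0 ≤ N := norm_nonneg _
  have hr1 : 0 ≤ L ^ (q - 1) := Real.rpow_nonneg hpos.le _
  have hr2 : 0 ≤ L ^ (q - 2) := Real.rpow_nonneg hpos.le _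
  have hX₁ : 0 ≤ q * (q - 1) * L ^ (q - 2) * S :=
    mul_nonneg (mul_nonneg (mul_nonneg hq0.le hq1) hr2) hS0
  have hX₂ : 0 ≤ q * L ^ (q - 1) * (L - torusStrainMidEig v x) * G :=
    mul_nonneg (mul_nonneg (mul_nonneg hq0.le hr1) hgap.le) hG0
  have hY₁ : 0 ≤ (q - 1) / q * (N ^ 2 * L ^ (q - 2)) :=
    mul_nonneg (div_nonneg hq1 hq0.le) (mul_nonneg (sq_nonneg _) hr2)
  have hY₂ : 0 ≤ 3 / q * (N ^ 2 * L ^ (q - 1) / (L - torusStrainMidEig v x)) :=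
    mul_nonneg (div_nonneg (by norm_num) hq0.le) (div_nonneg (mul_nonneg (sq_nonneg _) hr1) hgap.le)
  have e1 : N * ((q - 1) * L ^ (q - 2) * Real.sqrt S) =
      Real.sqrt (q * (q - 1) * L ^ (q - 2) * S) * Real.sqrt ((q - 1) / q * (N ^ 2 * L ^ (q - 2))) := by
    rw [← Real.sqrt_mul hX₁, show q * (q - 1) * L ^ (q - 2) * S * ((q - 1) / q * (N ^ 2 * L ^ (q - 2))) =
      (N * ((q - 1) * L ^ (q - 2))) ^ 2 * S by field_simp, Real.sqrt_mul (sq_nonneg _),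
      Real.sqrt_sq (mul_nonneg hN0 (mul_nonneg hq1 hr2))]
    ring
  have e2 : N * (L ^ (q - 1) * (Real.sqrt 3 * Real.sqrt G)) =
      Real.sqrt (q * L ^ (q - 1) * (L - torusStrainMidEig v x) * G) *
        Real.sqrt (3 / q * (N ^ 2 * L ^ (q - 1) / (L - torusStrainMidEig v x))) := by
    rw [← Real.sqrt_mul hX₂, show q * L ^ (q - 1) * (L - torusStrainMidEig v x) * G *
      (3 / q * (N ^ 2 * L ^ (q - 1) / (L - torusStrainMidEig v x))) = (N * L ^ (q - 1)) ^ 2 * (3 * G) by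
      field_simp, Real.sqrt_mul (sq_nonneg _), Real.sqrt_sq (mul_nonneg hN0 hr1),
      Real.sqrt_mul (by norm_num : (0:ℝ) ≤ 3)]
    ring
  have h0 := abs_transport_rpow_topProj_le hv hdiv hsimple q x
  rw [abs_of_nonneg hq1] at h0
  refine h0.trans ?_
  rw [mul_add, e1, e2]
  exact sqrt_mul_sqrt_add_le hX₁ hX₂ hY₁ hY₂

/-- **§ 2 MASTER RULE AT LEVEL `q` (R15)**:
`Φ_q(v)² ≤ [((q−1)/q) ∫‖v‖²λ₁^{q−2} + (3/q) ∫‖v‖²λ₁^{q−1}/(λ₁ − λ₂)] · heatDissipation Φ_q v` for every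
real `q ≥ 1` on everywhere-simple smooth divergence-free fields (K67 § 1, § 1, Hölder, K67 § 3). [ours] -/
theorem topEigMoment_sq_le_channels_mul_heatDissipation (hq : 1 ≤ q) (hv : Torus.IsSmooth v)
    (hdiv : Torus.IsDivFree v)
    (hsimple : ∀ x : UnitAddTorus (Fin 3), torusStrainMidEig v x < torusStrainTopEig v x) :
    torusTopEigMoment q v ^ 2 ≤
      ((q - 1) / q * (∫ x, ‖v x‖ ^ 2 * torusStrainTopEig v x ^ (q - 2)) +
        3 / q * ∫ x, ‖v x‖ ^ 2 * torusStrainTopEig v x ^ (q - 1) /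
          (torusStrainTopEig v x - torusStrainMidEig v x)) *
        heatDissipation (torusTopEigMoment q) v := by
  have hgf := gapForm_of_simple'' hsimple
  have hpos := topEig_pos'' hv hdiv hsimple
  have hls : Torus.IsSmooth (torusStrainTopEig v) := isSmooth_torusStrainTopEig_of_simple hv hgf
  have hl := hls.continuous
  have hm := continuous_torusStrainMidEig hv
  have hP : ∀ i j, Torus.IsSmooth (fun y => topProj v y i j) := isSmooth_topProj_entry hv hsimple
  have hQ : ∀ i j, Torus.IsSmooth (fun y => torusStrainTopEig v y ^ (q - 1) * topProj v y i j) :=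
    fun i j => by simpa only [smul_eq_mul] using (isSmooth_rpow_of_pos hls hpos (q - 1)).smul' (hP i j)
  set F : UnitAddTorus (Fin 3) → ℝ := fun x => q * (q - 1) * torusStrainTopEig v x ^ (q - 2) *
        ∑ k, Torus.partialDeriv k (torusStrainTopEig v) x ^ 2 +
      q * torusStrainTopEig v x ^ (q - 1) * (torusStrainTopEig v x - torusStrainMidEig v x) *
        ∑ k, ∑ i, ∑ j, Torus.partialDeriv k (fun y => topProj v y i j) x ^ 2 with hF
  set Y : UnitAddTorus (Fin 3) → ℝ := fun x => (q - 1) / q * (‖v x‖ ^ 2 * torusStrainTopEig v x ^ (q - 2)) +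
      3 / q * (‖v x‖ ^ 2 * torusStrainTopEig v x ^ (q - 1) /
        (torusStrainTopEig v x - torusStrainMidEig v x)) with hY
  have hq0 : 0 < q := by linarith
  have hF0 : ∀ x, 0 ≤ F x := fun x =>
    add_nonneg (mul_nonneg (mul_nonneg (mul_nonneg hq0.le (by linarith)) (Real.rpow_nonneg (hpos x).le _))
      (Finset.sum_nonneg fun k _ => sq_nonneg _))
      (mul_nonneg (strainGapWeight_pos hq0 hv hdiv hsimple x).le (Finset.sum_nonneg fun k _ =>
        Finset.sum_nonneg fun i _ => Finset.sum_nonneg fun j _ => sq_nonneg _))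
  have hY0 : ∀ x, 0 ≤ Y x := fun x =>
    add_nonneg (mul_nonneg (div_nonneg (sub_nonneg.2 hq) hq0.le)
      (mul_nonneg (sq_nonneg _) (Real.rpow_nonneg (hpos x).le _)))
      (mul_nonneg (div_nonneg (by norm_num) hq0.le) (div_nonneg
        (mul_nonneg (sq_nonneg _) (Real.rpow_nonneg (hpos x).le _)) (sub_pos.2 (hsimple x)).le))
  have hFc : Continuous F :=
    (((continuous_const.mul (hl.rpow_const fun x => Or.inl (hpos x).ne')).mul
      (continuous_finsetSum _ fun k _ => (hls.partialDeriv k).continuous.pow 2)).add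
      ((continuous_strainGapWeight hq hv).mul (continuous_sum_sq_partialDeriv_topProj hv hsimple)))
  have hn2 : Continuous fun x => ‖v x‖ ^ 2 := hv.continuous.norm.pow 2
  have i1 : Integrable fun x => ‖v x‖ ^ 2 * torusStrainTopEig v x ^ (q - 2) :=
    (hn2.mul (hl.rpow_const fun x => Or.inl (hpos x).ne')).integrable_unitAddTorus
  have i2 : Integrable fun x => ‖v x‖ ^ 2 * torusStrainTopEig v x ^ (q - 1) /
      (torusStrainTopEig v x - torusStrainMidEig v x) :=
    ((hn2.mul (hl.rpow_const fun x => Or.inr (by linarith))).div (hl.sub hm)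
      fun x => (sub_pos.2 (hsimple x)).ne').integrable_unitAddTorus
  have hYc : Continuous Y := (continuous_const.mul (hn2.mul (hl.rpow_const fun x =>
      Or.inl (hpos x).ne'))).add (continuous_const.mul (((hn2.mul (hl.rpow_const fun x =>
        Or.inr (by linarith))).div (hl.sub hm) fun x => (sub_pos.2 (hsimple x)).ne')))
  have hpc : Continuous fun x => ∑ j, v x j * ∑ i, Torus.partialDeriv i
      (fun y => torusStrainTopEig v y ^ (q - 1) * topProj v y i j) x :=
    continuous_finsetSum _ fun j _ => (hv.apply j).continuous.mul
      (continuous_finsetSum _ fun i _ => ((hQ i j).partialDeriv i).continuous)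
  -- Step 1: `Φ_q ≤ ∫ √F √Y` (K67 § 1 transport identity, § 1 pointwise)
  have h1 : torusTopEigMoment q v ≤ ∫ x, Real.sqrt (F x) * Real.sqrt (Y x) := by
    rw [topEigMoment_eq_neg_integral_transport_rpow hv hdiv hsimple q]
    refine (neg_le_abs _).trans (abs_integral_le_integral_abs.trans
      (integral_mono hpc.integrable_unitAddTorus.abs (hFc.sqrt.mul hYc.sqrt).integrable_unitAddTorus
        fun x => abs_transport_rpow_topProj_le_sqrt_mul_sqrt hq hv hdiv hsimple x))
  -- Step 2: Hölder (2,2)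
  have hH := integral_mul_le_Lp_mul_Lq_of_nonneg Real.HolderConjugate.two_two
    (ae_of_all _ fun x => Real.sqrt_nonneg (F x)) (ae_of_all _ fun x => Real.sqrt_nonneg (Y x))
    (hFc.sqrt.memLp_of_hasCompactSupport (μ := volume) (HasCompactSupport.of_compactSpace _))
    (hYc.sqrt.memLp_of_hasCompactSupport (μ := volume) (HasCompactSupport.of_compactSpace _))
  have e1 : ∫ x, Real.sqrt (F x) ^ (2:ℝ) = ∫ x, F x :=
    integral_congr_ae (ae_of_all _ fun x => by simp only [Real.rpow_two, Real.sq_sqrt (hF0 x)])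
  have e2 : ∫ x, Real.sqrt (Y x) ^ (2:ℝ) = ∫ x, Y x :=
    integral_congr_ae (ae_of_all _ fun x => by simp only [Real.rpow_two, Real.sq_sqrt (hY0 x)])
  rw [e1, e2, ← Real.sqrt_eq_rpow, ← Real.sqrt_eq_rpow] at hH
  -- Step 3: square and insert K67 § 3
  have hΦ0 : 0 ≤ torusTopEigMoment q v := by
    rw [torusTopEigMoment_eq_integral_rpow_of_simple hv hdiv hsimple q]
    exact integral_nonneg fun x => Real.rpow_nonneg (hpos x).le _
  have hIF0 : 0 ≤ ∫ x, F x := integral_nonneg fun x => hF0 x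
  have hIY0 : 0 ≤ ∫ x, Y x := integral_nonneg fun x => hY0 x
  have hIF : ∫ x, F x ≤ heatDissipation (torusTopEigMoment q) v :=
    integral_channels_le_heatDissipation hq hv hdiv hsimple
  have hYsplit : ∫ x, Y x = (q - 1) / q * (∫ x, ‖v x‖ ^ 2 * torusStrainTopEig v x ^ (q - 2)) +
      3 / q * ∫ x, ‖v x‖ ^ 2 * torusStrainTopEig v x ^ (q - 1) /
        (torusStrainTopEig v x - torusStrainMidEig v x) := by
    rw [← integral_const_mul, ← integral_const_mul, ← integral_add (i1.const_mul _) (i2.const_mul _)]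
  calc torusTopEigMoment q v ^ 2 ≤ (Real.sqrt (∫ x, F x) * Real.sqrt (∫ x, Y x)) ^ 2 :=
        pow_le_pow_left₀ hΦ0 (h1.trans hH) 2
    _ = (∫ x, F x) * ∫ x, Y x := by rw [mul_pow, Real.sq_sqrt hIF0, Real.sq_sqrt hIY0]
    _ ≤ heatDissipation (torusTopEigMoment q) v * ∫ x, Y x := mul_le_mul_of_nonneg_right hIF hIY0
    _ = _ := by rw [hYsplit, mul_comm]

/-- **§ 3 KILL RULE (R15′)**: on an everywhere-simple smooth divergence-free `v` with `Φ_q(v) > 0` and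
`heatDissipation Φ_q v ≤ c Φ_q(v)` (`q ≥ 1`):
`Φ_q(v) ≤ c [((q−1)/q) ∫‖v‖²λ₁^{q−2} + (3/q) ∫‖v‖²λ₁^{q−1}/(λ₁ − λ₂)]` — along an everywhere-simple killing
family for L-λ(q) the amplitude channel or the `λ₁^{q−1}‖v‖²`-weighted inverse gap must blow up relative
to `Φ_q`. [ours] -/
theorem topEigMoment_le_channels_of_heat_le (hq : 1 ≤ q) (hv : Torus.IsSmooth v) (hdiv : Torus.IsDivFree v)
    (hsimple : ∀ x : UnitAddTorus (Fin 3), torusStrainMidEig v x < torusStrainTopEig v x)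
    (hΦ : 0 < torusTopEigMoment q v) {c : ℝ}
    (hc : heatDissipation (torusTopEigMoment q) v ≤ c * torusTopEigMoment q v) :
    torusTopEigMoment q v ≤ c * ((q - 1) / q * (∫ x, ‖v x‖ ^ 2 * torusStrainTopEig v x ^ (q - 2)) +
      3 / q * ∫ x, ‖v x‖ ^ 2 * torusStrainTopEig v x ^ (q - 1) /
        (torusStrainTopEig v x - torusStrainMidEig v x)) := by
  have hpos := topEig_pos'' hv hdiv hsimple
  have hq0 : 0 < q := by linarith
  have hY0 : 0 ≤ (q - 1) / q * (∫ x, ‖v x‖ ^ 2 * torusStrainTopEig v x ^ (q - 2)) +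
      3 / q * ∫ x, ‖v x‖ ^ 2 * torusStrainTopEig v x ^ (q - 1) /
        (torusStrainTopEig v x - torusStrainMidEig v x) :=
    add_nonneg (mul_nonneg (div_nonneg (sub_nonneg.2 hq) hq0.le) (integral_nonneg fun x =>
      mul_nonneg (sq_nonneg _) (Real.rpow_nonneg (hpos x).le _)))
      (mul_nonneg (div_nonneg (by norm_num) hq0.le) (integral_nonneg fun x => div_nonneg
        (mul_nonneg (sq_nonneg _) (Real.rpow_nonneg (hpos x).le _)) (sub_pos.2 (hsimple x)).le))
  have h := (topEigMoment_sq_le_channels_mul_heatDissipation hq hv hdiv hsimple).trans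
    (mul_le_mul_of_nonneg_left hc hY0)
  refine le_of_mul_le_mul_right ?_ hΦ
  calc torusTopEigMoment q v * torusTopEigMoment q v = torusTopEigMoment q v ^ 2 := (sq _).symm
    _ ≤ _ := h
    _ = _ := by ring

/-- **§ 3, `q = 2`**: `Φ₂(v) ≤ c [E(v)/2 + (3/2) ∫‖v‖²λ₁/(λ₁ − λ₂)]` with `E(v) = ∫‖v‖²` — at `q = 2` the
amplitude channel is the bare energy, so a kill at bounded `E/Φ₂` must come from the `λ₁‖v‖²`-weighted
inverse gap. [ours] -/
theorem topEigMoment_two_le_of_heat_le (hv : Torus.IsSmooth v) (hdiv : Torus.IsDivFree v)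
    (hsimple : ∀ x : UnitAddTorus (Fin 3), torusStrainMidEig v x < torusStrainTopEig v x)
    (hΦ : 0 < torusTopEigMoment 2 v) {c : ℝ}
    (hc : heatDissipation (torusTopEigMoment 2) v ≤ c * torusTopEigMoment 2 v) :
    torusTopEigMoment 2 v ≤ c * (1 / 2 * (∫ x, ‖v x‖ ^ 2) +
      3 / 2 * ∫ x, ‖v x‖ ^ 2 * torusStrainTopEig v x /
        (torusStrainTopEig v x - torusStrainMidEig v x)) := by
  have h := topEigMoment_le_channels_of_heat_le (q := 2) (by norm_num) hv hdiv hsimple hΦ hc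
  simp only [show (2:ℝ) - 2 = 0 by norm_num, show (2:ℝ) - 1 = 1 by norm_num, Real.rpow_zero, mul_one,
    Real.rpow_one] at h
  exact h

end TopEig.InverseGap

end Summit.NavierStokesRegularity.FunctionalMining

end
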